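import Summits.QuantumFields.YangMills.Theorems.BalabanUVNodesN15KingModelIsserlisHafnian

/-!
# BalabanUVNodes ∕ N15 — THE KING-MODEL RUNG (PART Ͱ-d): WICK's THEOREM TO ALL ORDERS FOR EVERY GAUSSIAN FIELD OF THE TREE —
# `∫∏_{i∈S}φ(p_i) d(gaussianFieldOfKernel K) = Haf((K(p_u,p_v))_{u,v∈S})` for EVERY index set `ι` and EVERY positive-SEMIdefinite kernel `K`
# (degenerate covariances and infinite index sets included; the finite positive-definite case of part Ͱ-b is the engine)
# (Track A, DAG node N15 = NE2; FAN-OUT v1.1 §N15 s3 «KING-MODEL RUNG»; uses parts Ͱ-b (Isserlis for `ρ_A dx`), Ϝ-s (polarization), Ϝ-u (`gaussLaw`, `IsGaussian`),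
# the tree's `Literature…CurvatureGaussianField` (Kolmogorov-built `gaussianFieldOfKernel`, uniqueness) and Mathlib's `CFC.sqrt`; count-neutral)

HONEST FRAMING.  Count-neutral (cell `pub-ymgap`, seat `pub-ymgap-dag-n15-e` g34; `--supports stmt-QuantumFields-27366 --as helper` = K3⁸
`SpineGivenEndpointR13SepCoPHV`).  Folklore probability (Isserlis 1918 ∕ Wick 1950) for the tree's general Gaussian field
`Literature.MathematicalPhysics.QuantumFieldTheory.gaussianFieldOfKernel K : Measure (ι → ℝ)` — the Kolmogorov extension of the centred Gaussian laws with
covariance kernel `K` (Kallenberg Lemma 13.1), `ι` ANY index type, `K` ANY positive-semidefinite kernel.  Part Ͱ-b proved Isserlis for the density-defined law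
`ρ_A dx` ([King1986] (C. King, Commun. Math. Phys. **102** (1986) 649–677) (2.6) p.652), hence for `gaussianFieldOfKernel (A⁻¹)` with `ι` finite and `A⁻¹`
positive-DEFINITE.  This file removes both restrictions: (1) DEGENERATE kernels on a finite index type `κ`: with `B = √Σ` (Mathlib's `CFC.sqrt`, `BB = Σ`,
`Bᵀ = B`) the push-forward of the standard law `ρ_1 dw` under `w ↦ Bw` is a centred Gaussian probability measure whose coordinate process has covariance
`(BBᵀ)_{st} = Σ_{st}` (part Ϝ-s's polarization), hence IS `gaussianFieldOfKernel Σ` by the tree's uniqueness theorem; and `∏φ(p_i)` pulls back to the product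
of the LINEAR FORMS `⟨B_{p_i},w⟩` of the non-degenerate `w`, to which part Ͱ-b applies — the Gram matrix `⟨B_{p_u},B_{p_v}⟩` is `Σ(p_u,p_v)`; (2) ANY index set:
the integrand depends on the coordinates in the finite set `p(S)` only, the marginal of `gaussianFieldOfKernel K` there is the tree's `gaussianFamilyOfKernel K I`
(`gaussianFieldOfKernel_map_restrict`), which is identified with `gaussianFieldOfKernel (K|_I)` on the finite type `I` by the same uniqueness theorem.
NEAREST PRIOR ART (v1.1 ERRATUM, correcting the v1.0 sentence «no all-orders Wick theorem anywhere in the tree or Mathlib», which was WRONG): the tree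
ALREADY proves all-orders Wick for `gaussianFieldOfKernel` — `Balaban1983to89/HiggsFluctMeasureWickPairingSum.integral_prod_eval_eq_wickSum`
(`∫∏_{i<2k}φ(x_i)dμ_K = wickSum (K(x_i,x_j)) univ`, every index set, every PSD `K`, from `Literature/Probability/Distributions/GaussianWickTheorem`'s
`GaussianWick.integral_prod_eq_pairingSum` for centred Mathlib-`IsGaussianProcess`es), with the literal `pairPartitions` form, and
`…HiggsFluctMeasureWickExponentialModels.integral_prod_linF_eq_wickSum` for finitely supported functionals.  What THIS file adds: the HAFNIAN currency
(bridged to `wickSum`∕`fsPairing`∕`pairingSum` BY NAME in `Literature/Combinatorics/Enumerative/HafnianWickSum.lean`), arbitrary finite families `S : Finset W`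
(not only `Fin (2k)`), an independent route (push-forward of the density law `ρ_1` under `√C` + part Ͱ-b), and the two identifications
`map_mulVec_sqrt_gaussLaw_one_eq_gaussianFieldOfKernel`, `gaussianFamilyOfKernel_eq_gaussianFieldOfKernel`.  CONSUMERS: King's block-field laws (parts
Ϝ-u∕Ϝ-v∕Ͱ-c) and every other `gaussianFieldOfKernel` of the tree (e.g. `curvatureGaussianField`, whose kernel is semidefinite on an infinite index set).
NOT a node discharge (N15 is booked through n15-a's knit, untouched here); nothing Bałaban ∕ continuum-Yang–Mills ∕ `ℝ⁴` ∕ OS ∕ mass-gap ∕ Clay.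
0 `sorry`, 0 def; standard axioms.

WHAT THIS FILE PROVES (kernel).  §1 the standard law `ρ_1`: `coercive_one`, `isGaussianProcess_eval_of_isGaussian` (every `IsGaussian` measure on `ℝ^κ`),
`measurable_mulVec`, `integral_mulVec_eval_gaussLaw_one` (`= 0`), `integral_mulVec_eval_mul_gaussLaw_one` (`= (BBᵀ)_{st}`); §2 the square root: `sqrt_mul_sqrt`,
`sqrt_transpose`, `dot_sqrt_row_eq` (`⟨B_s,B_t⟩ = Σ_{st}`), `isPosSemidefKernel_of_posSemidef`; ★★ **`map_mulVec_sqrt_gaussLaw_one_eq_gaussianFieldOfKernel`**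
(`(ρ_1 dw)∘(√Σ·)⁻¹ = gaussianFieldOfKernel Σ`, every PSD `Σ` on a finite type); §3 ★★★ **`integral_prod_eval_gaussianFieldOfKernel_eq_hafnian_of_posSemidef`** (finite
type, PSD kernel); §4 ANY index set: `isPosSemidefKernel_restrict`, ★★ `gaussianFamilyOfKernel_eq_gaussianFieldOfKernel` (the marginal law on `I` IS the Gaussian field of
`K|_I`), ★★★ **`integral_prod_eval_gaussianFieldOfKernel_eq_hafnian`** (WICK TO ALL ORDERS, every `ι`, every PSD `K`, every finite family of points with repetitions),
★★ `integral_prod_eval_gaussianFieldOfKernel_eq_zero_of_odd`, ★★ `integral_eval_pow_even_gaussianFieldOfKernel` (`∫φ(s)^{2k} = (2k−1)!!·K(s,s)^k`),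
`integral_eval_mul_eval_gaussianFieldOfKernel` (`∫φ(s)φ(t) = K(s,t)`, the product form of the tree's covariance statement).

HONEST SCOPE.  Centred Gaussian fields only; coordinates `φ(p_i)` (linear functionals of finitely many coordinates follow by multilinearity but are not spelled
out); folklore.  N15 untouched; counts unmoved.  Locators (use): [King1986] (2.6) p.652, (2.15) p.653, Thm 2.1 (2.22)–(2.23) p.654.
-/

noncomputable section

open scoped BigOperators MatrixOrder
open Finset Matrix Filter Topology MeasureTheory ProbabilityTheory

namespace Summit.QuantumFields.YangMills.BalabanUVNodes.N15KingModelRung.FreeField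

open Literature.MathematicalPhysics.QuantumFieldTheory (IsPosSemidefKernel covGram gaussianFieldOfKernel gaussianFamilyOfKernel
  eq_gaussianFieldOfKernel_of_isGaussianProcess gaussianFieldOfKernel_map_restrict isProbabilityMeasure_gaussianFieldOfKernel
  integral_eval_gaussianFamilyOfKernel covariance_eval_gaussianFamilyOfKernel)
open Literature.MathematicalPhysics.QuantumFieldTheory.Balaban1983to89.QGQInverse (Coercive isUnit_of_coercive)
open Literature.Combinatorics.Enumerative (hafnian)
open Literature.Combinatorics.Enumerative.HafnianGeneratingFunction (subMat)

/-! ## §1 The standard law `ρ_1 dw` on `ℝ^κ` and its linear images -/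

section Standard

variable {κ : Type*} [Fintype κ] [DecidableEq κ]

/-- The identity precision is coercive with constant `1`. [folklore] -/
theorem coercive_one : Coercive (1 : Matrix κ κ ℝ) 1 := fun x => by simp

omit [DecidableEq κ] in
/-- Every Gaussian measure on `ℝ^κ` (Mathlib's `IsGaussian`) has a Gaussian coordinate process (restrictions are continuous linear images). [folklore] -/
theorem isGaussianProcess_eval_of_isGaussian (ν : Measure (κ → ℝ)) [IsGaussian ν] :
    IsGaussianProcess (fun (s : κ) (ω : κ → ℝ) => ω s) ν := by
  refine ⟨fun I => ⟨?_⟩⟩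
  have e : (fun ω : κ → ℝ => I.restrict fun s => ω s)
      = ⇑(ContinuousLinearMap.pi fun i : I => ContinuousLinearMap.proj (R := ℝ) (φ := fun _ : κ => ℝ) (i : κ)) := by
    funext ω
    rfl
  rw [e]
  infer_instance

omit [DecidableEq κ] in
/-- `w ↦ Bw` is measurable. [folklore] -/
theorem measurable_mulVec (B : Matrix κ κ ℝ) : Measurable fun w : κ → ℝ => B *ᵥ w := by
  refine measurable_pi_iff.mpr fun i => ?_
  simp only [Matrix.mulVec, dotProduct]
  fun_prop

/-- `(Bw)_s = ⟨B_s, w⟩` has mean zero under `ρ_1 dw`. [folklore] -/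
theorem integral_mulVec_eval_gaussLaw_one (B : Matrix κ κ ℝ) (s : κ) :
    ∫ w, (B *ᵥ w) s ∂gaussLaw (1 : Matrix κ κ ℝ) = 0 := by
  rw [integral_gaussLaw_real one_pos coercive_one]
  exact integral_dot_gaussDensity one_pos coercive_one Matrix.transpose_one (fun j => B s j)

/-- `∫(Bw)_s(Bw)_t ρ_1(w)dw = (BBᵀ)_{st}` (part Ϝ-s's polarization at `A = 1`). [folklore] -/
theorem integral_mulVec_eval_mul_gaussLaw_one (B : Matrix κ κ ℝ) (s t : κ) :
    ∫ w, (B *ᵥ w) s * (B *ᵥ w) t ∂gaussLaw (1 : Matrix κ κ ℝ) = (B * Bᵀ) s t := by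
  rw [integral_gaussLaw_real one_pos coercive_one]
  have h := integral_dot_mul_dot_gaussDensity one_pos coercive_one Matrix.transpose_one (fun j => B s j) (fun j => B t j)
  rw [inv_one, Matrix.one_mulVec] at h
  rw [Matrix.mul_apply]
  simpa [Matrix.mulVec, dotProduct, Matrix.transpose_apply] using h

end Standard

/-! ## §2 The square root of a positive-semidefinite matrix and the push-forward representation of `gaussianFieldOfKernel Σ` -/

section SquareRoot

variable {κ : Type*} [Fintype κ] [DecidableEq κ]

/-- `√Σ·√Σ = Σ` for positive-semidefinite `Σ` (Mathlib's continuous functional calculus). [folklore] -/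
theorem sqrt_mul_sqrt {C : Matrix κ κ ℝ} (hC : C.PosSemidef) : CFC.sqrt C * CFC.sqrt C = C :=
  CFC.sqrt_mul_sqrt_self _ hC.nonneg

/-- `√Σ` is symmetric. [folklore] -/
theorem sqrt_transpose (C : Matrix κ κ ℝ) : (CFC.sqrt C)ᵀ = CFC.sqrt C := by
  have h : (CFC.sqrt C).PosSemidef := Matrix.nonneg_iff_posSemidef.mp (CFC.sqrt_nonneg C)
  have h2 := h.isHermitian.eq
  rwa [Matrix.conjTranspose_eq_transpose_of_trivial] at h2

/-- The rows of `B = √Σ` form a Gram representation of `Σ`: `⟨B_s, B_t⟩ = (BBᵀ)_{st} = Σ_{st}`. [folklore] -/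
theorem dot_sqrt_row_eq {C : Matrix κ κ ℝ} (hC : C.PosSemidef) (s t : κ) :
    (fun j => CFC.sqrt C s j) ⬝ᵥ ((1 : Matrix κ κ ℝ)⁻¹ *ᵥ fun j => CFC.sqrt C t j) = C s t := by
  rw [inv_one, Matrix.one_mulVec]
  have h : (CFC.sqrt C * (CFC.sqrt C)ᵀ) s t = C s t := by rw [sqrt_transpose, sqrt_mul_sqrt hC]
  rw [Matrix.mul_apply] at h
  simpa [dotProduct, Matrix.transpose_apply] using h

omit [Fintype κ] [DecidableEq κ] in
/-- A positive-semidefinite matrix is a positive-semidefinite kernel on its (finite) index type. [folklore] -/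
theorem isPosSemidefKernel_of_posSemidef {C : Matrix κ κ ℝ} (hC : C.PosSemidef) : IsPosSemidefKernel fun s t : κ => C s t :=
  fun _ => hC.submatrix _

/-- ★★ **THE PUSH-FORWARD REPRESENTATION**: for every positive-SEMIdefinite `Σ` on a finite type, the image of the standard law `ρ_1 dw` under `w ↦ √Σ·w`
IS the tree's `gaussianFieldOfKernel Σ` (a centred Gaussian probability measure whose coordinate process has covariance `(√Σ√Σᵀ)_{st} = Σ_{st}`; uniqueness,
Kallenberg Lemma 13.1). [folklore] -/
theorem map_mulVec_sqrt_gaussLaw_one_eq_gaussianFieldOfKernel {C : Matrix κ κ ℝ} (hC : C.PosSemidef) :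
    (gaussLaw (1 : Matrix κ κ ℝ)).map (fun w => CFC.sqrt C *ᵥ w) = gaussianFieldOfKernel fun s t : κ => C s t := by
  set B : Matrix κ κ ℝ := CFC.sqrt C with hB
  haveI : IsProbabilityMeasure (gaussLaw (1 : Matrix κ κ ℝ)) := isProbabilityMeasure_gaussLaw one_pos coercive_one
  haveI : IsGaussian (gaussLaw (1 : Matrix κ κ ℝ)) := isGaussian_gaussLaw one_pos coercive_one Matrix.transpose_one
  have hfun : (fun w : κ → ℝ => B *ᵥ w) = ⇑(LinearMap.toContinuousLinearMap (Matrix.mulVecLin B)) := by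
    funext w
    rfl
  haveI : IsProbabilityMeasure ((gaussLaw (1 : Matrix κ κ ℝ)).map fun w => B *ᵥ w) :=
    Measure.isProbabilityMeasure_map (measurable_mulVec B).aemeasurable
  haveI : IsGaussian ((gaussLaw (1 : Matrix κ κ ℝ)).map fun w => B *ᵥ w) := by
    rw [hfun]
    infer_instance
  refine eq_gaussianFieldOfKernel_of_isGaussianProcess (isPosSemidefKernel_of_posSemidef hC)
    (isGaussianProcess_eval_of_isGaussian _) (fun s => ?_) (fun s t => ?_)
  · rw [integral_map (measurable_mulVec B).aemeasurable (measurable_pi_apply s).aestronglyMeasurable]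
    exact integral_mulVec_eval_gaussLaw_one B s
  · rw [ProbabilityTheory.covariance, integral_map (measurable_mulVec B).aemeasurable (measurable_pi_apply s).aestronglyMeasurable,
      integral_map (measurable_mulVec B).aemeasurable (measurable_pi_apply t).aestronglyMeasurable,
      integral_mulVec_eval_gaussLaw_one B s, integral_mulVec_eval_gaussLaw_one B t]
    simp only [sub_zero]
    rw [integral_map (measurable_mulVec B).aemeasurable (f := fun ω : κ → ℝ => ω s * ω t)
      (Continuous.aestronglyMeasurable (by fun_prop)),
      integral_mulVec_eval_mul_gaussLaw_one B s t, hB, sqrt_transpose, sqrt_mul_sqrt hC]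

end SquareRoot

/-! ## §3 Wick to all orders on a finite index type, positive-SEMIdefinite kernel -/

section FiniteType

variable {κ : Type*} [Fintype κ] [DecidableEq κ] {W : Type*} [DecidableEq W] [LinearOrder W]

/-- ★★★ **WICK ∕ ISSERLIS FOR A DEGENERATE GAUSSIAN VECTOR**: for every positive-semidefinite `Σ` on a finite type `κ`, points `p : W → κ` and finite `S`,
`∫∏_{i∈S}φ(p_i) d(gaussianFieldOfKernel Σ) = Haf((Σ(p_u,p_v))_{u,v∈S})` — pull back along `w ↦ √Σw` to the product of the linear forms `⟨(√Σ)_{p_i}, w⟩` of the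
standard law and apply part Ͱ-b. [folklore] -/
theorem integral_prod_eval_gaussianFieldOfKernel_eq_hafnian_of_posSemidef {C : Matrix κ κ ℝ} (hC : C.PosSemidef) (p : W → κ)
    (S : Finset W) :
    ∫ φ, (∏ i ∈ S, φ (p i)) ∂gaussianFieldOfKernel (fun s t : κ => C s t)
      = hafnian (subMat (Matrix.of fun u v : W => C (p u) (p v)) S) := by
  rw [← map_mulVec_sqrt_gaussLaw_one_eq_gaussianFieldOfKernel hC,
    integral_map (measurable_mulVec _).aemeasurable (Continuous.aestronglyMeasurable (by fun_prop))]
  have e : (fun w : κ → ℝ => ∏ i ∈ S, (CFC.sqrt C *ᵥ w) (p i)) = fun w => ∏ i ∈ S, (fun j => CFC.sqrt C (p i) j) ⬝ᵥ w := by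
    funext w
    rfl
  rw [e, integral_prod_dot_gaussLaw_eq_hafnian one_pos coercive_one Matrix.transpose_one _ S]
  congr 2
  ext u v
  simp only [Matrix.of_apply]
  exact dot_sqrt_row_eq hC (p u) (p v)

end FiniteType

/-! ## §4 Any index set: the marginal on `p(S)` and WICK TO ALL ORDERS for `gaussianFieldOfKernel K` -/

section AnyIndex

variable {ι : Type*} [DecidableEq ι] {W : Type*} [DecidableEq W] [LinearOrder W]

omit [DecidableEq ι] in
/-- The restriction of a positive-semidefinite kernel to a subset of indices is positive semidefinite. [folklore] -/
theorem isPosSemidefKernel_restrict {K : ι → ι → ℝ} (hK : IsPosSemidefKernel K) (I : Finset ι) :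
    IsPosSemidefKernel fun s t : I => K s t := by
  classical
  intro J
  have h := (hK (J.map (Function.Embedding.subtype _))).submatrix
    (fun j : J => (⟨(j : I), Finset.mem_map_of_mem _ j.2⟩ : ↥(J.map (Function.Embedding.subtype _))))
  exact h

/-- ★★ **THE MARGINAL LAW ON A FINITE SET OF INDICES IS THE GAUSSIAN FIELD OF THE RESTRICTED KERNEL**: `gaussianFamilyOfKernel K I = gaussianFieldOfKernel (K|_I)`
(both are centred Gaussian probability measures on `ℝ^I` with coordinate covariance `K|_I`; uniqueness). [folklore] -/
theorem gaussianFamilyOfKernel_eq_gaussianFieldOfKernel {K : ι → ι → ℝ} (hK : IsPosSemidefKernel K) (I : Finset ι) :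
    gaussianFamilyOfKernel K I = gaussianFieldOfKernel fun s t : I => K s t :=
  eq_gaussianFieldOfKernel_of_isGaussianProcess (isPosSemidefKernel_restrict hK I) (isGaussianProcess_eval_of_isGaussian _)
    (fun s => integral_eval_gaussianFamilyOfKernel K I s) (fun s t => covariance_eval_gaussianFamilyOfKernel hK I s t)

/-- ★★★ **WICK's THEOREM TO ALL ORDERS FOR THE TREE's GAUSSIAN FIELDS**: for EVERY index set `ι`, EVERY positive-semidefinite kernel `K`, every family of
points `p : W → ι` (repetitions allowed) and every finite `S`,
`∫∏_{i∈S}φ(p_i) d(gaussianFieldOfKernel K) = Haf((K(p_u,p_v))_{u,v∈S})` — the sum over the perfect matchings of `S` of the products of the matched covariances.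
[folklore] -/
theorem integral_prod_eval_gaussianFieldOfKernel_eq_hafnian {K : ι → ι → ℝ} (hK : IsPosSemidefKernel K) (p : W → ι) (S : Finset W) :
    ∫ φ, (∏ i ∈ S, φ (p i)) ∂gaussianFieldOfKernel K = hafnian (subMat (Matrix.of fun u v : W => K (p u) (p v)) S) := by
  classical
  -- the finite set of indices the integrand depends on, and the points as a map `S → I`
  let I : Finset ι := S.image p
  let q : S → I := fun i => ⟨p i, Finset.mem_image_of_mem p i.2⟩
  -- (a) the integrand is a cylinder function over `I`
  have h1 : ∫ φ, (∏ i ∈ S, φ (p i)) ∂gaussianFieldOfKernel K = ∫ φ, (∏ i : S, (I.restrict φ) (q i)) ∂gaussianFieldOfKernel K :=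
    integral_congr_ae (Eventually.of_forall fun φ => by
      show ∏ i ∈ S, φ (p i) = ∏ i : S, φ (p i)
      exact (Finset.prod_coe_sort S fun i => φ (p i)).symm)
  -- (b) integrate over the marginal on `I`, which is the Gaussian field of the restricted kernel
  have hmap := integral_map (μ := gaussianFieldOfKernel K) (Finset.measurable_restrict I).aemeasurable
    (f := fun x : I → ℝ => ∏ i : S, x (q i)) (Continuous.aestronglyMeasurable (by fun_prop))
  rw [gaussianFieldOfKernel_map_restrict hK I, gaussianFamilyOfKernel_eq_gaussianFieldOfKernel hK I] at hmap
  -- (c) Wick on the finite type `I` (positive-semidefinite Gram matrix `covGram K I`) for the points `q : S → I`, all of `S`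
  have hq := integral_prod_eval_gaussianFieldOfKernel_eq_hafnian_of_posSemidef (W := S) (hK I) q Finset.univ
  simp only [Literature.MathematicalPhysics.QuantumFieldTheory.covGram_apply] at hq
  -- (d) the two hafnians: `subMat (…) univ` on the type `S` vs `subMat (…) S` on `W`
  have hU : hafnian (subMat (Matrix.of fun u v : S => K (q u) (q v)) Finset.univ)
      = hafnian (subMat (Matrix.of fun u v : W => K (p u) (p v)) S) :=
    Literature.Combinatorics.Enumerative.HafnianGeneratingFunction.hafnian_submatrix_equiv
      (Equiv.subtypeUnivEquiv Finset.mem_univ) (fun _ _ h => h) _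
  exact h1.trans (hmap.symm.trans (hq.trans hU))

/-- ★★ **Odd moments vanish** for every Gaussian field of the tree. [folklore] -/
theorem integral_prod_eval_gaussianFieldOfKernel_eq_zero_of_odd {K : ι → ι → ℝ} (hK : IsPosSemidefKernel K) (p : W → ι) {S : Finset W}
    (hodd : Odd S.card) :
    ∫ φ, (∏ i ∈ S, φ (p i)) ∂gaussianFieldOfKernel K = 0 := by
  rw [integral_prod_eval_gaussianFieldOfKernel_eq_hafnian hK p S]
  exact hafnian_eq_zero_of_odd_card (by rwa [Fintype.card_coe]) _

/-- ★★ **The even moments of one coordinate**: `∫φ(s)^{2k} d(gaussianFieldOfKernel K) = (2k−1)!!·K(s,s)^k`. [folklore] -/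
theorem integral_eval_pow_even_gaussianFieldOfKernel {K : ι → ι → ℝ} (hK : IsPosSemidefKernel K) (s : ι) (k : ℕ) :
    ∫ φ, φ s ^ (2 * k) ∂gaussianFieldOfKernel K = (Nat.doubleFactorial (2 * k - 1) : ℝ) * K s s ^ k := by
  have h := integral_prod_eval_gaussianFieldOfKernel_eq_hafnian (W := Fin (2 * k)) hK (fun _ => s) Finset.univ
  have hU : hafnian (subMat (Matrix.of fun _ _ : Fin (2 * k) => K s s) Finset.univ) = hafnian (Matrix.of fun _ _ : Fin (2 * k) => K s s) :=
    Literature.Combinatorics.Enumerative.HafnianGeneratingFunction.hafnian_submatrix_equiv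
      (Equiv.subtypeUnivEquiv Finset.mem_univ) (fun _ _ h => h) _
  simp only [Finset.prod_const, Finset.card_univ, Fintype.card_fin] at h
  rw [h, hU]
  exact hafnian_of_const _ (Fintype.card_fin _)

/-- The odd moments of one coordinate vanish: `∫φ(s)^{2k+1} d(gaussianFieldOfKernel K) = 0`. [folklore] -/
theorem integral_eval_pow_odd_gaussianFieldOfKernel {K : ι → ι → ℝ} (hK : IsPosSemidefKernel K) (s : ι) (k : ℕ) :
    ∫ φ, φ s ^ (2 * k + 1) ∂gaussianFieldOfKernel K = 0 := by
  have h := integral_prod_eval_gaussianFieldOfKernel_eq_zero_of_odd (W := Fin (2 * k + 1)) hK (fun _ => s) (S := Finset.univ)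
    (by rw [Finset.card_univ, Fintype.card_fin]; exact odd_two_mul_add_one k)
  simp only [Finset.prod_const, Finset.card_univ, Fintype.card_fin] at h
  exact h

/-- The product form of the tree's covariance statement: `∫φ(s)φ(t) d(gaussianFieldOfKernel K) = K(s,t)` (the one perfect matching of two points). [folklore] -/
theorem integral_eval_mul_eval_gaussianFieldOfKernel {K : ι → ι → ℝ} (hK : IsPosSemidefKernel K) (s t : ι) :
    ∫ φ, φ s * φ t ∂gaussianFieldOfKernel K = K s t := by
  have h := integral_prod_eval_gaussianFieldOfKernel_eq_hafnian (W := Fin 2) hK ![s, t] Finset.univ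
  have hU : hafnian (subMat (Matrix.of fun u v : Fin 2 => K (![s, t] u) (![s, t] v)) Finset.univ)
      = hafnian (Matrix.of fun u v : Fin 2 => K (![s, t] u) (![s, t] v)) :=
    Literature.Combinatorics.Enumerative.HafnianGeneratingFunction.hafnian_submatrix_equiv
      (Equiv.subtypeUnivEquiv Finset.mem_univ) (fun _ _ h => h) _
  rw [hU, Literature.Combinatorics.Enumerative.HafnianExpansion.hafnian_fin_eq_sum_row_zero,
    show (Finset.univ : Finset (Fin 2)).erase 0 = {1} by decide, Finset.sum_singleton] at h
  haveI : IsEmpty (Literature.Combinatorics.Enumerative.HafnianExpansion.Compl2 (0 : Fin 2) 1) :=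
    ⟨fun x => by rcases x with ⟨x, h0, h1⟩; fin_cases x <;> simp_all⟩
  rw [Literature.Combinatorics.Enumerative.HafnianExpansion.hafnian_of_isEmpty, mul_one] at h
  simpa [Fin.prod_univ_two] using h

end AnyIndex

end Summit.QuantumFields.YangMills.BalabanUVNodes.N15KingModelRung.FreeField
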